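import Summits.Parity.BatemanHorn.Theses.IsogenyRedei

/-!
# `PolyMobiusTail` (crux stmt-Parity-0870) IS `Λ`-Bateman–Horn modulo the Type-I main term

Negative-side structure lemmas (cdisprove seat refuter-cdisprove-stmt-Parity-0870-0), all PROVED:

* `sum_prod_vonMangoldt_eq_typeI_add_tail` — the exact identity `∑_{n≤x} ∏ Λ(fᵢ(n)) = (-1)^k (TypeI_η + Tail_η)`
  for EVERY system, `η`, `x` (no hypothesis on `f`).
* `polyMobiusTail_iff_lambdaBatemanHorn` — **assuming the theorem-grade support `TypeIMainTerm`
  (stmt-Parity-0873), the crux is EQUIVALENT to the `Λ`-form of Bateman–Horn for every system**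
  (`∑_{n ≤ x} ∏ᵢ Λ(fᵢ(n)) ∼ C(f)·x`, the hypothesis of `LambdaToCount`). A disproof of the crux is therefore
  a disproof of Bateman–Horn for one explicit integer system; none is known (the function-field bias of
  Conrad–Conrad–Gross, `Literature.Barriers.Parity.FunctionFieldMobiusBias`, needs inseparable `f`).
* `polyMobiusTail_iff_forall_eta` — modulo `TypeIMainTerm`, `∃ η ∈ (0,1)` and `∀ η ∈ (0,1)` give the same
  statement (`tail_isLittleO_of_isEquivalent`): the truth value is `η`-independent inside the open interval.
* `tail_one_eq_neg_one_pow_mul_sum_prod_vonMangoldt` — at the closed endpoint `η = 1` the crux function of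
  ANY system with `k ≥ 1` is `(-1)^k ∑_{n≤x} ∏ Λ(fᵢ(n))` (the Type-I piece is empty, `typeI_one_eq_zero`):
  closing the `η`-range would negate Bateman–Horn itself.
* `sum_prod_vonMangoldt_lower_of_tail_lower`, `infinite_primePow_tuples_of_linear_lower` — ONE side of the
  crux suffices for prime tuples: an eventual lower bound `(-1)^k Tail_η ≥ -(1-δ) C(f) x` already gives
  `∑ ∏ Λ(fᵢ(n)) ≥ (δ/2) C(f) x`, hence infinitely many `n` with all `fᵢ(n)` prime powers — the lower half is
  the qualitative conjecture (lower-bound sieve problem), the upper half the asymptotic upper bound; Bombieri's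
  factor-2 indeterminacy (`Literature.NumberTheory.Sieve.bombieri_asymptotic_sieve_indeterminacy`) sits
  exactly across this two-sided gap.
* `tail_fin_one_eq_counted` — the `k = 1` slice in counted form:
  `Tail_η(g; x) = -∑_{n≤x} Λ(g(n)) - ∑_{d ≤ x^{1-η}} μ(d) log d · #{n ≤ x : d ∣ g(n) ≥ 1}` (bridge to `Λ` over
  polynomial values plus root-class counts of level `x^{1-η}`).
-/

namespace Summit.Parity.BatemanHorn.Theorems.PolyMobiusTail.Negative

open scoped BigOperators
open Filter Asymptotics Polynomial ArithmeticFunction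
open Literature.NumberTheory.Sieve
open Summit.Parity.BatemanHorn.Theses.IsogenyRedei (PolyMobiusTail TypeIMainTerm)

/-! ### Modulo `TypeIMainTerm` the crux is `Λ`-Bateman–Horn -/

/-- The exact identity behind the Type-I / tail split, for EVERY system, `η` and `x`:
`∑_{n ≤ x} ∏ᵢ Λ(fᵢ(n)) = (-1)^k · (TypeI_η(x) + Tail_η(x))` (`Λ = -(μ·log) ∗ 1` coordinatewise,
`Finset.prod_univ_sum`, complementary cut-offs). [folklore] -/
theorem sum_prod_vonMangoldt_eq_typeI_add_tail {k : ℕ} (f : Fin k → ℤ[X]) (η : ℝ) (x : ℕ) :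
    (∑ n ∈ Finset.Icc 1 x, ∏ i, vonMangoldt (((f i).eval (n : ℤ)).toNat))
      = (-1 : ℝ) ^ k * ((∑ n ∈ Finset.Icc 1 x,
          ∑ d ∈ Fintype.piFinset (fun i => (((f i).eval (n : ℤ)).toNat).divisors),
            if ∏ i, (d i : ℝ) ≤ (x : ℝ) ^ (1 - η) then ∏ i, ((moebius (d i) : ℝ) * Real.log (d i)) else 0)
        + (∑ n ∈ Finset.Icc 1 x,
          ∑ d ∈ Fintype.piFinset (fun i => (((f i).eval (n : ℤ)).toNat).divisors),
            if (x : ℝ) ^ (1 - η) < ∏ i, (d i : ℝ) then ∏ i, ((moebius (d i) : ℝ) * Real.log (d i)) else 0)) := by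
  have hΛ : ∀ m : ℕ, vonMangoldt m = -∑ e ∈ m.divisors, ((moebius e : ℝ) * Real.log e) := by
    intro m
    have h := sum_moebius_mul_log_eq (n := m)
    simp only [ArithmeticFunction.log_apply] at h
    linarith
  have stepA : ∀ n : ℕ, (∏ i, vonMangoldt (((f i).eval (n : ℤ)).toNat))
      = (-1 : ℝ) ^ k * ∑ d ∈ Fintype.piFinset (fun i => (((f i).eval (n : ℤ)).toNat).divisors),
          ∏ i, ((moebius (d i) : ℝ) * Real.log (d i)) := by
    intro n
    simp_rw [hΛ]
    rw [Finset.prod_neg, Finset.card_univ, Fintype.card_fin, Finset.prod_univ_sum]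
  have stepB : ∀ n : ℕ,
      (∑ d ∈ Fintype.piFinset (fun i => (((f i).eval (n : ℤ)).toNat).divisors),
          ∏ i, ((moebius (d i) : ℝ) * Real.log (d i)))
      = (∑ d ∈ Fintype.piFinset (fun i => (((f i).eval (n : ℤ)).toNat).divisors),
          if ∏ i, (d i : ℝ) ≤ (x : ℝ) ^ (1 - η) then ∏ i, ((moebius (d i) : ℝ) * Real.log (d i)) else 0)
        + (∑ d ∈ Fintype.piFinset (fun i => (((f i).eval (n : ℤ)).toNat).divisors),
          if (x : ℝ) ^ (1 - η) < ∏ i, (d i : ℝ) then ∏ i, ((moebius (d i) : ℝ) * Real.log (d i)) else 0) := by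
    intro n
    rw [← Finset.sum_add_distrib]
    refine Finset.sum_congr rfl fun d _ => ?_
    by_cases h : ∏ i, (d i : ℝ) ≤ (x : ℝ) ^ (1 - η)
    · rw [if_pos h, if_neg (not_lt.mpr h), add_zero]
    · rw [if_neg h, if_pos (not_le.mp h), zero_add]
  rw [← Finset.sum_add_distrib, Finset.mul_sum]
  refine Finset.sum_congr rfl fun n _ => ?_
  rw [stepA n, stepB n]

/-- At the endpoint `η = 1` the Type-I piece is EMPTY for `k ≥ 1`: `∏ dᵢ ≤ x⁰ = 1` forces every `dᵢ = 1`,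
whose weight `∏ μ(1) log 1` vanishes. [folklore] -/
theorem typeI_one_eq_zero {k : ℕ} (hk : 0 < k) (f : Fin k → ℤ[X]) (x : ℕ) :
    (∑ n ∈ Finset.Icc 1 x, ∑ d ∈ Fintype.piFinset (fun i => (((f i).eval (n : ℤ)).toNat).divisors),
        if ∏ i, (d i : ℝ) ≤ (x : ℝ) ^ (1 - (1 : ℝ)) then ∏ i, ((moebius (d i) : ℝ) * Real.log (d i)) else 0) = 0 := by
  refine Finset.sum_eq_zero fun n _ => Finset.sum_eq_zero fun d hd => ?_
  split_ifs with h
  · -- every coordinate is `1`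
    rw [sub_self, Real.rpow_zero] at h
    have hd1 : ∀ i, 1 ≤ d i := fun i =>
      Nat.pos_of_mem_divisors (Fintype.mem_piFinset.mp hd i)
    have hall : ∀ i, d i = 1 := by
      by_contra hne
      push Not at hne
      obtain ⟨j, hj⟩ := hne
      have hj2 : 2 ≤ d j := lt_of_le_of_ne (hd1 j) (Ne.symm hj)
      have hprodN : 2 ≤ ∏ i, d i :=
        hj2.trans (Finset.single_le_prod' (fun i _ => hd1 i) (Finset.mem_univ j))
      have hprod : (2 : ℝ) ≤ ∏ i, (d i : ℝ) := by exact_mod_cast hprodN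
      linarith
    refine Finset.prod_eq_zero (Finset.mem_univ (⟨0, hk⟩ : Fin k)) ?_
    simp [hall]
  · rfl


/-- **The endpoint `η = 1` is the full `Λ`-sum** for every system with `k ≥ 1`:
`Tail₁(x) = (-1)^k ∑_{n ≤ x} ∏ᵢ Λ(fᵢ(n))`. Hence, for a BH system, closing the `η`-range at `1` would
assert `∑ ∏ Λ(fᵢ(n)) = o(x)`, the NEGATION of Bateman–Horn (`C(f) > 0`); for `(X)` it is `-ψ(x)`
(`Negative/CancellationAcrossN.lean`). [folklore] -/
theorem tail_one_eq_neg_one_pow_mul_sum_prod_vonMangoldt {k : ℕ} (hk : 0 < k) (f : Fin k → ℤ[X]) (x : ℕ) :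
    (∑ n ∈ Finset.Icc 1 x, ∑ d ∈ Fintype.piFinset (fun i => (((f i).eval (n : ℤ)).toNat).divisors),
        if (x : ℝ) ^ (1 - (1 : ℝ)) < ∏ i, (d i : ℝ) then ∏ i, ((moebius (d i) : ℝ) * Real.log (d i)) else 0)
      = (-1 : ℝ) ^ k * ∑ n ∈ Finset.Icc 1 x, ∏ i, vonMangoldt (((f i).eval (n : ℤ)).toNat) := by
  rw [sum_prod_vonMangoldt_eq_typeI_add_tail f 1 x, typeI_one_eq_zero hk f x, zero_add, ← mul_assoc,
    ← pow_add, ← two_mul, pow_mul, neg_one_sq, one_pow, one_mul]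

/-- **The crux is `Λ`-Bateman–Horn modulo the Type-I main term.** Assuming the theorem-grade support item
`TypeIMainTerm` (stmt-Parity-0873), `PolyMobiusTail` is EQUIVALENT to: for every BH system,
`∑_{n ≤ x} ∏ᵢ Λ(fᵢ(n)) ∼ C·x` with `HasBatemanHornConst f C`, `C > 0` (the hypothesis of `LambdaToCount`).
`→` is the routes' `closes` minus `LambdaToCount`; `←` takes `η = 1/2`, identifies the two constants by
uniqueness of the ordered Euler-product limit and subtracts two `∼ C x` asymptotics. Consequently every
disproof of the crux is a disproof of Bateman–Horn for an explicit system, and conversely. [folklore] -/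
theorem polyMobiusTail_iff_lambdaBatemanHorn (hMain : TypeIMainTerm) :
    PolyMobiusTail ↔ ∀ (k : ℕ) (f : Fin k → ℤ[X]), IsBatemanHornSystem f →
      ∃ C : ℝ, 0 < C ∧ HasBatemanHornConst f C ∧
        (fun x : ℕ => ∑ n ∈ Finset.Icc 1 x, ∏ i, vonMangoldt (((f i).eval (n : ℤ)).toNat))
          ~[atTop] (fun x : ℕ => C * (x : ℝ)) := by
  constructor
  · intro hTail k f hf
    obtain ⟨η, hη0, hη1, hT⟩ := hTail k f hf
    obtain ⟨C, hC, hHas, hM⟩ := hMain k f hf η hη0 hη1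
    refine ⟨C, hC, hHas, ?_⟩
    have hB := (hT.const_mul_left ((-1 : ℝ) ^ k)).trans_isBigO
      (isBigO_self_const_mul hC.ne' (fun x : ℕ => (x : ℝ)) atTop)
    refine (hM.add_isLittleO hB).congr_left (Eventually.of_forall fun x => ?_)
    simp only [Pi.add_apply]
    rw [sum_prod_vonMangoldt_eq_typeI_add_tail f η x, mul_add]
  · intro hΛ k f hf
    refine ⟨1 / 2, by norm_num, by norm_num, ?_⟩
    obtain ⟨C₁, -, hHas₁, hL⟩ := hΛ k f hf
    obtain ⟨C₂, -, hHas₂, hM⟩ := hMain k f hf (1 / 2) (by norm_num) (by norm_num)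
    have hCC : C₁ = C₂ := tendsto_nhds_unique hHas₁ hHas₂
    subst hCC
    have hA := hL.isLittleO.trans_isBigO (isBigO_const_mul_self C₁ (fun x : ℕ => (x : ℝ)) atTop)
    have hB := hM.isLittleO.trans_isBigO (isBigO_const_mul_self C₁ (fun x : ℕ => (x : ℝ)) atTop)
    have hC := (hA.sub hB).const_mul_left ((-1 : ℝ) ^ k)
    refine hC.congr_left fun x => ?_
    simp only [Pi.sub_apply]
    rw [sum_prod_vonMangoldt_eq_typeI_add_tail f (1 / 2) x]
    have h1 : ((-1 : ℝ) ^ k) ^ 2 = 1 := by rw [← pow_mul, mul_comm, pow_mul, neg_one_sq, one_pow]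
    linear_combination (∑ n ∈ Finset.Icc 1 x,
          ∑ d ∈ Fintype.piFinset (fun i => (((f i).eval (n : ℤ)).toNat).divisors),
            if (x : ℝ) ^ (1 - (1 / 2 : ℝ)) < ∏ i, (d i : ℝ) then ∏ i, ((moebius (d i) : ℝ) * Real.log (d i)) else 0) * h1

/-! ### `∃ η` versus `∀ η` -/

/-- If the `Λ`-sum of a system satisfies `∑_{n≤x} ∏ Λ(fᵢ(n)) ∼ C·x` with the SAME constant as its Type-I
main term at `η`, then the tail at `η` is `o(x)` (subtract two `∼ C x` asymptotics). [folklore] -/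
theorem tail_isLittleO_of_isEquivalent {k : ℕ} (f : Fin k → ℤ[X]) {η C : ℝ}
    (hL : (fun x : ℕ => ∑ n ∈ Finset.Icc 1 x, ∏ i, vonMangoldt (((f i).eval (n : ℤ)).toNat))
      ~[atTop] (fun x : ℕ => C * (x : ℝ)))
    (hM : (fun x : ℕ => (-1 : ℝ) ^ k * ∑ n ∈ Finset.Icc 1 x,
      ∑ d ∈ Fintype.piFinset (fun i => (((f i).eval (n : ℤ)).toNat).divisors),
        if ∏ i, (d i : ℝ) ≤ (x : ℝ) ^ (1 - η) then ∏ i, ((moebius (d i) : ℝ) * Real.log (d i)) else 0)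
      ~[atTop] (fun x : ℕ => C * (x : ℝ))) :
    (fun x : ℕ => ∑ n ∈ Finset.Icc 1 x,
      ∑ d ∈ Fintype.piFinset (fun i => (((f i).eval (n : ℤ)).toNat).divisors),
        if (x : ℝ) ^ (1 - η) < ∏ i, (d i : ℝ) then ∏ i, ((moebius (d i) : ℝ) * Real.log (d i)) else 0)
      =o[atTop] (fun x : ℕ => (x : ℝ)) := by
  have hA := hL.isLittleO.trans_isBigO (isBigO_const_mul_self C (fun x : ℕ => (x : ℝ)) atTop)
  have hB := hM.isLittleO.trans_isBigO (isBigO_const_mul_self C (fun x : ℕ => (x : ℝ)) atTop)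
  have hC := (hA.sub hB).const_mul_left ((-1 : ℝ) ^ k)
  refine hC.congr_left fun x => ?_
  simp only [Pi.sub_apply]
  rw [sum_prod_vonMangoldt_eq_typeI_add_tail f η x]
  have h1 : ((-1 : ℝ) ^ k) ^ 2 = 1 := by rw [← pow_mul, mul_comm, pow_mul, neg_one_sq, one_pow]
  linear_combination (∑ n ∈ Finset.Icc 1 x,
        ∑ d ∈ Fintype.piFinset (fun i => (((f i).eval (n : ℤ)).toNat).divisors),
          if (x : ℝ) ^ (1 - η) < ∏ i, (d i : ℝ) then ∏ i, ((moebius (d i) : ℝ) * Real.log (d i)) else 0) * h1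

/-- **`∃ η` versus `∀ η` is immaterial modulo `TypeIMainTerm`**: assuming the theorem-grade Type-I main
term, `PolyMobiusTail` (some `η ∈ (0,1)` per system) already implies the tail bound for EVERY
`η ∈ (0,1)` — the truth value does not depend on `η` inside the open interval; the only boundary
phenomenon is the closed endpoint `η = 1` (`Negative/CancellationAcrossN.lean`). [folklore] -/
theorem polyMobiusTail_iff_forall_eta (hMain : TypeIMainTerm) :
    PolyMobiusTail ↔ ∀ (k : ℕ) (f : Fin k → ℤ[X]), IsBatemanHornSystem f → ∀ η : ℝ, 0 < η → η < 1 →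
      (fun x : ℕ => ∑ n ∈ Finset.Icc 1 x,
        ∑ d ∈ Fintype.piFinset (fun i => (((f i).eval (n : ℤ)).toNat).divisors),
          if (x : ℝ) ^ (1 - η) < ∏ i, (d i : ℝ) then ∏ i, ((moebius (d i) : ℝ) * Real.log (d i)) else 0)
        =o[atTop] fun x : ℕ => (x : ℝ) := by
  constructor
  · intro hTail k f hf η hη0 hη1
    -- first extract the Λ-asymptotic from the crux at its own η₀
    obtain ⟨η₀, h0, h1, hT⟩ := hTail k f hf
    obtain ⟨C₀, hC₀, hHas₀, hM₀⟩ := hMain k f hf η₀ h0 h1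
    have hB := (hT.const_mul_left ((-1 : ℝ) ^ k)).trans_isBigO
      (isBigO_self_const_mul hC₀.ne' (fun x : ℕ => (x : ℝ)) atTop)
    have hL : (fun x : ℕ => ∑ n ∈ Finset.Icc 1 x, ∏ i, vonMangoldt (((f i).eval (n : ℤ)).toNat))
        ~[atTop] (fun x : ℕ => C₀ * (x : ℝ)) := by
      refine (hM₀.add_isLittleO hB).congr_left (Eventually.of_forall fun x => ?_)
      simp only [Pi.add_apply]
      rw [sum_prod_vonMangoldt_eq_typeI_add_tail f η₀ x, mul_add]
    -- then subtract at the requested η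
    obtain ⟨C, -, hHas, hM⟩ := hMain k f hf η hη0 hη1
    have hCC : C₀ = C := tendsto_nhds_unique hHas₀ hHas
    subst hCC
    exact tail_isLittleO_of_isEquivalent f hL hM
  · intro h k f hf
    exact ⟨1 / 2, by norm_num, by norm_num, h k f hf (1 / 2) (by norm_num) (by norm_num)⟩

/-! ### One side of the crux already yields prime tuples -/

/-- **One side of the crux already yields prime tuples.** Assume the theorem-grade `TypeIMainTerm`. If for a
BH system the signed tail `(-1)^k · Tail_η` is merely bounded BELOW by `-(1-δ)·C(f)·x` eventually (instead of
being `o(x)`), then `∑_{n ≤ x} ∏ Λ(fᵢ(n)) ≥ (δ/2)·C(f)·x` eventually — in particular infinitely many `n`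
make every `fᵢ(n)` a prime power. So the "lower" half of `PolyMobiusTail` is the qualitative Hardy–Littlewood /
Bateman–Horn conjecture (lower-bound sieve problem), the "upper" half the asymptotic upper bound; both halves
are parity-blocked (Bombieri's factor-`2` indeterminacy covers exactly this two-sided gap). [folklore] -/
theorem sum_prod_vonMangoldt_lower_of_tail_lower (hMain : TypeIMainTerm) {k : ℕ} {f : Fin k → ℤ[X]}
    (hf : IsBatemanHornSystem f) {η : ℝ} (hη0 : 0 < η) (hη1 : η < 1) {δ : ℝ} (hδ : 0 < δ)
    (hlow : ∀ᶠ x : ℕ in atTop, -(1 - δ) * batemanHornConst f * (x : ℝ)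
      ≤ (-1 : ℝ) ^ k * ∑ n ∈ Finset.Icc 1 x,
          ∑ d ∈ Fintype.piFinset (fun i => (((f i).eval (n : ℤ)).toNat).divisors),
            if (x : ℝ) ^ (1 - η) < ∏ i, (d i : ℝ) then ∏ i, ((moebius (d i) : ℝ) * Real.log (d i)) else 0) :
    ∀ᶠ x : ℕ in atTop, δ / 2 * batemanHornConst f * (x : ℝ)
      ≤ ∑ n ∈ Finset.Icc 1 x, ∏ i, vonMangoldt (((f i).eval (n : ℤ)).toNat) := by
  obtain ⟨C, hC, hHas, hM⟩ := hMain k f hf η hη0 hη1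
  have hCeq : batemanHornConst f = C := hHas.batemanHornConst_eq
  rw [hCeq] at hlow ⊢
  -- from `(-1)^k TypeI ∼ C x`: eventually `(-1)^k TypeI ≥ (1 - δ/2) C x`
  have hM' := hM.isLittleO.def (half_pos hδ)
  filter_upwards [hlow, hM', eventually_ge_atTop 1] with x hlo hup hx1
  rw [Pi.sub_apply, Real.norm_eq_abs, Real.norm_eq_abs, abs_of_pos (by positivity : 0 < C * (x : ℝ))] at hup
  have hup' := (abs_le.mp hup).1
  rw [sum_prod_vonMangoldt_eq_typeI_add_tail f η x, mul_add]
  nlinarith [hup', hlo, hC]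

/-- A linear lower bound on `∑_{n ≤ x} ∏ Λ(fᵢ(n))` forces infinitely many `n` at which every `fᵢ(n)` is a
prime power. [folklore] -/
theorem infinite_primePow_tuples_of_linear_lower {k : ℕ} (f : Fin k → ℤ[X]) {c : ℝ} (hc : 0 < c)
    (h : ∀ᶠ x : ℕ in atTop, c * (x : ℝ) ≤ ∑ n ∈ Finset.Icc 1 x, ∏ i, vonMangoldt (((f i).eval (n : ℤ)).toNat)) :
    {n : ℕ | ∀ i, IsPrimePow (((f i).eval (n : ℤ)).toNat)}.Infinite := by
  set a : ℕ → ℝ := fun n => ∏ i, vonMangoldt (((f i).eval (n : ℤ)).toNat) with ha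
  have ha0 : ∀ n, 0 ≤ a n := fun n => Finset.prod_nonneg fun i _ => vonMangoldt_nonneg
  have hpos : ∀ n, 0 < a n → ∀ i, IsPrimePow (((f i).eval (n : ℤ)).toNat) := by
    intro n hn i
    have hne : vonMangoldt (((f i).eval (n : ℤ)).toNat) ≠ 0 := by
      intro h0
      exact hn.ne' (Finset.prod_eq_zero (Finset.mem_univ i) h0)
    exact vonMangoldt_pos_iff.mp (lt_of_le_of_ne vonMangoldt_nonneg (Ne.symm hne))
  by_contra hfin
  rw [Set.not_infinite] at hfin
  obtain ⟨N, hN⟩ := hfin.bddAbove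
  -- beyond `N` every term vanishes, so the partial sums are bounded by `B`
  set B : ℝ := ∑ n ∈ Finset.Icc 1 N, a n with hB
  have hzero : ∀ n, N < n → a n = 0 := by
    intro n hn
    by_contra hne
    have hp := hpos n (lt_of_le_of_ne (ha0 n) (Ne.symm hne))
    exact absurd (hN hp) (not_le.mpr hn)
  have hbound : ∀ x : ℕ, ∑ n ∈ Finset.Icc 1 x, a n ≤ B := by
    intro x
    have hsub : ∑ n ∈ (Finset.Icc 1 x).filter (fun n => n ≤ N), a n = ∑ n ∈ Finset.Icc 1 x, a n := by
      refine Finset.sum_subset (Finset.filter_subset _ _) fun n hn hnot => ?_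
      simp only [Finset.mem_filter, not_and, not_le] at hnot
      exact hzero n (hnot hn)
    rw [← hsub]
    refine Finset.sum_le_sum_of_subset_of_nonneg ?_ fun n _ _ => ha0 n
    intro n hn
    simp only [Finset.mem_filter, Finset.mem_Icc] at hn ⊢
    exact ⟨hn.1.1, hn.2⟩
  -- contradiction with `c x → ∞`
  have hev := h.and (eventually_gt_atTop ⌈B / c⌉₊)
  obtain ⟨x, hx, hxB⟩ := hev.exists
  have hx' : B / c < x := lt_of_le_of_lt (Nat.le_ceil _) (by exact_mod_cast hxB)
  rw [div_lt_iff₀ hc] at hx'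
  have := (hx.trans (hbound x))
  nlinarith

/-! ### The `k = 1` slice in counted form -/

/-- Sums over `Fintype.piFinset` of a `Fin 1`-indexed family are sums over the single factor. [folklore] -/
private theorem sum_piFinset_fin_one₃ (t : Fin 1 → Finset ℕ) (G : ℕ → ℝ) :
    ∑ d ∈ Fintype.piFinset t, G (d 0) = ∑ j ∈ t 0, G j := by
  have h := Finset.prod_univ_sum t (fun _ j => G j)
  simp only [Fin.prod_univ_one] at h
  exact h.symm

/-- **The `k = 1` slice in counted form.** For one polynomial `g`, every real `η` and every `x`:
`Tail_η(g; x) = -∑_{n ≤ x} Λ(g(n)) - ∑_{d ≤ x^{1-η}} μ(d) log d · #{n ≤ x : d ∣ g(n), g(n) ≥ 1}`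
(values `g(n) ≤ 0` are sent to `0` by `Int.toNat` and carry no divisors). This is the bridge from the
crux to "`Λ` over the values of `g`" plus root-class counts `#{n ≤ x : d ∣ g(n)}` of level `x^{1-η}`
(the Type-I side, cf. `TypeIMainTerm`). [folklore] -/
theorem tail_fin_one_eq_counted (g : ℤ[X]) (η : ℝ) (x : ℕ) :
    (∑ n ∈ Finset.Icc 1 x, ∑ d ∈ Fintype.piFinset (fun i => (((![g] i).eval (n : ℤ)).toNat).divisors),
        if (x : ℝ) ^ (1 - η) < ∏ i, (d i : ℝ) then ∏ i, ((moebius (d i) : ℝ) * Real.log (d i)) else 0)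
      = -(∑ n ∈ Finset.Icc 1 x, vonMangoldt ((g.eval (n : ℤ)).toNat))
        - ∑ d ∈ Finset.Icc 1 ⌊(x : ℝ) ^ (1 - η)⌋₊, (moebius d : ℝ) * Real.log d *
            (((Finset.Icc 1 x).filter (fun n : ℕ => d ∣ (g.eval (n : ℤ)).toNat ∧ (g.eval (n : ℤ)).toNat ≠ 0)).card : ℝ) := by
  set y : ℝ := (x : ℝ) ^ (1 - η) with hy
  have hy0 : 0 ≤ y := Real.rpow_nonneg (Nat.cast_nonneg x) _
  -- one variable
  have h1 : ∀ n : ℕ, (∑ d ∈ Fintype.piFinset (fun i => (((![g] i).eval (n : ℤ)).toNat).divisors),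
        if y < ∏ i, (d i : ℝ) then ∏ i, ((moebius (d i) : ℝ) * Real.log (d i)) else 0)
      = ∑ d ∈ ((g.eval (n : ℤ)).toNat).divisors, if y < (d : ℝ) then (moebius d : ℝ) * Real.log d else 0 := by
    intro n
    simp only [Fin.prod_univ_one, Matrix.cons_val_fin_one]
    exact sum_piFinset_fin_one₃ (fun _ => ((g.eval (n : ℤ)).toNat).divisors)
      (fun j => if y < (j : ℝ) then (moebius j : ℝ) * Real.log j else 0)
  -- pointwise: tail_n = -Λ(m) - ∑_{d ≤ ⌊y⌋} μ(d) log d · [d ∣ m, m ≠ 0]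
  have h2 : ∀ m : ℕ, (∑ d ∈ m.divisors, if y < (d : ℝ) then (moebius d : ℝ) * Real.log d else 0)
      = -vonMangoldt m - ∑ d ∈ Finset.Icc 1 ⌊y⌋₊,
          if d ∣ m ∧ m ≠ 0 then (moebius d : ℝ) * Real.log d else 0 := by
    intro m
    rw [← sum_moebius_mul_log_eq]
    -- split the divisor sum at `y`
    have hsplit := Finset.sum_filter_add_sum_filter_not m.divisors (fun d : ℕ => y < (d : ℝ))
      (fun d : ℕ => (moebius d : ℝ) * Real.log d)
    rw [← Finset.sum_filter]
    have hsmall : ∑ d ∈ m.divisors.filter (fun d : ℕ => ¬ y < (d : ℝ)), (moebius d : ℝ) * Real.log d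
        = ∑ d ∈ Finset.Icc 1 ⌊y⌋₊, if d ∣ m ∧ m ≠ 0 then (moebius d : ℝ) * Real.log d else 0 := by
      rw [← Finset.sum_filter]
      refine Finset.sum_congr ?_ fun _ _ => rfl
      ext d
      simp only [Finset.mem_filter, Nat.mem_divisors, Finset.mem_Icc, not_lt]
      constructor
      · rintro ⟨⟨hdm, hm⟩, hdy⟩
        exact ⟨⟨Nat.pos_of_dvd_of_pos hdm (Nat.pos_of_ne_zero hm), Nat.le_floor hdy⟩, hdm, hm⟩
      · rintro ⟨⟨-, hdf⟩, hdm, hm⟩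
        exact ⟨⟨hdm, hm⟩, (Nat.le_floor_iff hy0).mp hdf⟩
    simp only [ArithmeticFunction.log_apply] at hsplit ⊢
    linarith [hsmall]
  simp only [h1, h2, Finset.sum_sub_distrib, Finset.sum_neg_distrib]
  congr 1
  rw [Finset.sum_comm]
  refine Finset.sum_congr rfl fun d _ => ?_
  rw [← Finset.sum_filter, Finset.sum_const, nsmul_eq_mul, mul_comm]

end Summit.Parity.BatemanHorn.Theorems.PolyMobiusTail.Negative
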